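import Mathlib
import Summits.Ventures.PercRepro2.Defs
import Summits.Ventures.PercRepro2.Independence
import Summits.Ventures.PercRepro2.Harris
import Summits.Ventures.PercRepro2.Graph
import Summits.Ventures.PercRepro2.Exploration
import Summits.Ventures.PercRepro2.Events
import Summits.Ventures.PercRepro2.FourFunctions
import Summits.Ventures.PercRepro2.Induced
import Summits.Ventures.PercRepro2.Frontier
import Summits.Ventures.PercRepro2.ObsIndependence
import Summits.Ventures.PercRepro2.BHK
import Summits.Ventures.PercRepro2.BHKEvents
import Summits.Ventures.PercRepro2.VdBKahn
import Summits.Ventures.PercRepro2.BHKAvoid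

/-!
# The (K) inequality: one explored cluster, one avoided vertex, two marks
(blind cell PercRepro2, typer-1)

A finite graph, a source `a₂`, an avoided vertex `x`, two marks `o`, `b`; `S = C(a₂)` is the
explored cluster, `R = {a₂ ↮ x}`, `1_v = 1[v ∈ S]`, `ℓ(S) = P(x ↔ b in G ∖ S)` (`0` off `R`).
With the atoms `r = P(R)`, `a = P(a₂ ↔ o)`, `c = P(a₂ ↔ b)`, `poH = P(a₂ ↔ o, R)`,
`pbH = P(a₂ ↔ b, R)`, `J_HH = P(a₂ ↔ b, a₂ ↔ o, R)`, `pbL = P(x ↔ b, R)`,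
`J_LH = P(a₂ ↔ o, x ↔ b, R)`, the inequality `K_nonneg` reads
`(K)/2 = [a·pbL − J_LH] + [J_HH − a·pbH] + c·(r·a − poH) ≥ 0`
(first bracket a BHK 1.3 + Harris slack, second bracket of indefinite sign, sum nonnegative).

Proof: with `ψ = 1_b − ℓ` (an increasing cluster functional) and `η_o = r·a − poH`,
`r·(K)/2 = [r·E(1_o ψ 1_R) − E(1_o 1_R)·E(ψ 1_R)] + (E(1_o 1_R) − r·a)·(E(ψ 1_R) − r·E ψ) + r·pbL·η_o`
(`K_algebra`); the first bracket is the functional van den Berg–Häggström–Kahn inequality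
(`bhk_induced`, `X = Y = {x}`, functionals `1_o` and `1_b + (1 − ℓ)`; `bhk_K`), both factors of
the second term are `≤ 0` by Harris (an increasing functional of `S` is less likely on the
decreasing event `R`; `harris_o`, `harris_psi`), and `η_o ≥ 0` is Harris again.  `pbL`, `J_LH`
are expectations of `ℓ(S)` by the exploration tower identity
`prob_clusterIn_inter_avoid_eq_expect`.  If `r = 0` every `R`-atom vanishes.
-/

namespace Summit.Ventures.PercRepro2.CutVK

section Algebra

variable {R : Type*} [CommRing R] [LinearOrder R] [IsStrictOrderedRing R]

/-- **The algebra of (K)**: from the BHK inequality `key`, the two Harris inequalities `h1`,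
`h2` and nonnegativity of `r`, `pbL`, the (K) expression multiplied by `r` is nonnegative. -/
lemma K_algebra {r A C poH pbH JHH pbL JLH : R} (hr : 0 ≤ r) (hpbL : 0 ≤ pbL)
    (key : poH * (pbH + r - pbL) ≤ (JHH + poH - JLH) * r)
    (h1 : poH ≤ A * r) (h2 : pbH - pbL ≤ (C - pbL) * r) :
    0 ≤ r * (A * pbL - JLH + JHH - A * pbH + C * (r * A - poH)) := by
  have t1 : 0 ≤ r * (JHH - JLH) - poH * (pbH - pbL) := by linarith
  have t2 : 0 ≤ (poH - r * A) * ((pbH - pbL) - r * (C - pbL)) :=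
    mul_nonneg_of_nonpos_of_nonpos (by linarith) (by linarith)
  have t3 : 0 ≤ r * pbL * (r * A - poH) := mul_nonneg (mul_nonneg hr hpbL) (by linarith)
  have e : r * (A * pbL - JLH + JHH - A * pbH + C * (r * A - poH)) =
      (r * (JHH - JLH) - poH * (pbH - pbL)) +
        (poH - r * A) * ((pbH - pbL) - r * (C - pbL)) + r * pbL * (r * A - poH) := by ring
  rw [e]
  exact add_nonneg (add_nonneg t1 t2) t3

end Algebra

section Pointwise

variable {V : Type*} {E : Type*} {ends : E → Sym2 V}

/-- `{a₂ ↮ x}` is the event that `x` is not in the cluster of `a₂`. -/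
lemma mem_avoidAll_singleton_iff {a₂ x : V} {ω : Config E} :
    ω ∈ avoidAll ends a₂ {x} ↔ cluster ends ω a₂ ∈ ({W | x ∉ W} : Set (Set V)) := by
  simp only [mem_avoidAll, Finset.mem_singleton, forall_eq, Set.mem_setOf_eq, mem_cluster]

/-- `{a₂ ↮ x}` is a decreasing event. -/
lemma isLowerSet_avoidAll_singleton (ends : E → Sym2 V) (a₂ x : V) :
    IsLowerSet (avoidAll ends a₂ {x}) := by
  intro ω ω' h hω y hy hc
  exact hω y hy (conn_mono h hc)

/-- The indicator of `{W | x ∉ W}` at the cluster of `a₂` is the indicator of `{a₂ ↮ x}`. -/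
lemma indicator_notMem_cluster_eq {R : Type*} [CommRing R] (a₂ x : V) (ω : Config E) :
    ({W | x ∉ W} : Set (Set V)).indicator (1 : Set V → R) (cluster ends ω a₂) =
      (avoidAll ends a₂ {x}).indicator (1 : Config E → R) ω := by
  by_cases h : ω ∈ avoidAll ends a₂ {x}
  · rw [Set.indicator_of_mem h, Set.indicator_of_mem (mem_avoidAll_singleton_iff.1 h)]
    rfl
  · rw [Set.indicator_of_notMem h,
      Set.indicator_of_notMem (fun h' => h (mem_avoidAll_singleton_iff.2 h'))]

/-- An indicator is idempotent. -/
lemma indicator_one_mul_self {R : Type*} [CommRing R] (A : Set (Config E)) (ω : Config E) :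
    A.indicator (1 : Config E → R) ω * A.indicator (1 : Config E → R) ω =
      A.indicator (1 : Config E → R) ω := by
  by_cases h : ω ∈ A <;> simp [h]

/-- `{W | v ∈ W}` is an up-set. -/
lemma isUpperSet_setOf_mem (v : V) : IsUpperSet ({W | v ∈ W} : Set (Set V)) :=
  fun _ _ h hW => h hW

/-- The indicator of `{W | x ∉ W}` is an antitone functional. -/
lemma antitone_indicator_notMem {R : Type*} [CommRing R] [LinearOrder R] [IsStrictOrderedRing R]
    (x : V) : Antitone (({W | x ∉ W} : Set (Set V)).indicator (1 : Set V → R)) := by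
  intro W W' h
  by_cases hW' : W' ∈ ({W | x ∉ W} : Set (Set V))
  · have hW : W ∈ ({W | x ∉ W} : Set (Set V)) := fun hx => hW' (h hx)
    simp [Set.indicator_of_mem hW, Set.indicator_of_mem hW']
  · rw [Set.indicator_of_notMem hW']
    exact Set.indicator_apply_nonneg fun _ => zero_le_one

/-- `{C(a₂) ∈ {W | v ∈ W}}` is the connection event `{a₂ ↔ v}`. -/
lemma clusterInEvent_setOf_mem (a₂ v : V) :
    clusterInEvent ends a₂ ({W | v ∈ W} : Set (Set V)) = connEvent ends a₂ v := rfl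

/-- `{C(a₂) ∈ 𝓤 ∩ 𝓥} = {C(a₂) ∈ 𝓤} ∩ {C(a₂) ∈ 𝓥}`. -/
lemma clusterInEvent_inter (a₂ : V) (𝓤 𝓥 : Set (Set V)) :
    clusterInEvent ends a₂ (𝓤 ∩ 𝓥) = clusterInEvent ends a₂ 𝓤 ∩ clusterInEvent ends a₂ 𝓥 := rfl

/-- `{C(a₂) ∈ univ}` is the sure event. -/
lemma clusterInEvent_univ (a₂ : V) :
    clusterInEvent ends a₂ (Set.univ : Set (Set V)) = Set.univ := by
  ext ω
  simp [clusterInEvent]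

end Pointwise

section Tower

variable {V : Type*} {E : Type*} [Fintype E] [DecidableEq E] [Fintype V]
  {R : Type*} [CommRing R]

/-- **Exploring `C(a₂)` with the avoided vertex `x`, for a connection from `x`**: for a family
`𝓤` of vertex sets, `P(C(a₂) ∈ 𝓤, x ↔ b, a₂ ↮ x) = E[1_𝓤(C(a₂)) · ℓ(C(a₂)) · 1_{a₂ ↮ x}]` with
`ℓ(W) = P(b ∈ C(x) in G ∖ W)` (`delClusterProb`). -/
theorem prob_connEvent_x_inter_avoid_eq_expect (p : E → R) (ends : E → Sym2 V) (a₂ x b : V)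
    (𝓤 : Set (Set V)) :
    prob p (clusterInEvent ends a₂ 𝓤 ∩ connEvent ends x b ∩ avoidAll ends a₂ {x}) =
      expect p (fun ω => 𝓤.indicator 1 (cluster ends ω a₂) *
        delClusterProb p ends x {W | b ∈ W} (cluster ends ω a₂) *
        (avoidAll ends a₂ {x}).indicator 1 ω) :=
  prob_clusterIn_inter_avoid_eq_expect p ends a₂ x (Finset.mem_singleton_self x) 𝓤 {W | b ∈ W}

omit [Fintype V] in
/-- `P(a₂ ↔ v) = E[1_v(C(a₂))]`. -/
lemma prob_connEvent_eq_expect (p : E → R) (ends : E → Sym2 V) (a₂ v : V) :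
    prob p (connEvent ends a₂ v) =
      expect p (fun ω => ({W | v ∈ W} : Set (Set V)).indicator 1 (cluster ends ω a₂)) := by
  have h := prob_clusterInEvent_inter_eq_expect p ends a₂ {W | v ∈ W} Set.univ
  simp only [Set.inter_univ, Set.indicator_univ, Pi.one_apply, mul_one,
    clusterInEvent_setOf_mem] at h
  exact h

omit [Fintype V] in
/-- `P(a₂ ↔ v, a₂ ↮ x) = E[1_v(C(a₂)) · 1_{a₂ ↮ x}]`. -/
lemma prob_connEvent_inter_avoid_eq_expect (p : E → R) (ends : E → Sym2 V) (x a₂ v : V) :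
    prob p (connEvent ends a₂ v ∩ avoidAll ends a₂ {x}) =
      expect p (fun ω => ({W | v ∈ W} : Set (Set V)).indicator 1 (cluster ends ω a₂) *
        (avoidAll ends a₂ {x}).indicator 1 ω) := by
  have h := prob_clusterInEvent_inter_eq_expect p ends a₂ {W | v ∈ W} (avoidAll ends a₂ {x})
  rw [clusterInEvent_setOf_mem] at h
  exact h

end Tower

section Main

variable {V : Type*} {E : Type*} [Fintype E] [DecidableEq E] [Fintype V] [DecidableEq V]
  {R : Type*} [CommRing R] [LinearOrder R] [IsStrictOrderedRing R]

/-- **The BHK instance of (K)** (`bhk_induced`, `X = Y = {x}`, functionals `1_o` and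
`1_b + (1 − ℓ)`), in the atoms `poH`, `pbH`, `r`, `pbL`, `J_HH`, `J_LH`:
`poH · (pbH + r − pbL) ≤ (J_HH + poH − J_LH) · r`. -/
theorem bhk_K (p : E → R) (hp : IsProbVec p) (ends : E → Sym2 V) (x a₂ o b : V) :
    expect p (fun ω => ({W | o ∈ W} : Set (Set V)).indicator 1 (cluster ends ω a₂) *
        (avoidAll ends a₂ {x}).indicator 1 ω) *
      (expect p (fun ω => ({W | b ∈ W} : Set (Set V)).indicator 1 (cluster ends ω a₂) *
          (avoidAll ends a₂ {x}).indicator 1 ω) +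
        prob p (avoidAll ends a₂ {x}) -
        expect p (fun ω => delClusterProb p ends x {W | b ∈ W} (cluster ends ω a₂) *
          (avoidAll ends a₂ {x}).indicator 1 ω)) ≤
    (expect p (fun ω => ({W | b ∈ W} : Set (Set V)).indicator 1 (cluster ends ω a₂) *
          ({W | o ∈ W} : Set (Set V)).indicator 1 (cluster ends ω a₂) *
          (avoidAll ends a₂ {x}).indicator 1 ω) +
        expect p (fun ω => ({W | o ∈ W} : Set (Set V)).indicator 1 (cluster ends ω a₂) *
          (avoidAll ends a₂ {x}).indicator 1 ω) -
        expect p (fun ω => ({W | o ∈ W} : Set (Set V)).indicator 1 (cluster ends ω a₂) *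
          delClusterProb p ends x {W | b ∈ W} (cluster ends ω a₂) *
          (avoidAll ends a₂ {x}).indicator 1 ω)) *
      prob p (avoidAll ends a₂ {x}) := by
  classical
  -- the functionals
  have hFo : Monotone (({W | o ∈ W} : Set (Set V)).indicator (1 : Set V → R)) :=
    monotone_indicator_one_of_isUpperSet (isUpperSet_setOf_mem o)
  have hFb : Monotone (({W | b ∈ W} : Set (Set V)).indicator (1 : Set V → R)) :=
    monotone_indicator_one_of_isUpperSet (isUpperSet_setOf_mem b)
  have hg_anti : Antitone (delClusterProb p ends x {W | b ∈ W}) :=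
    delClusterProb_anti p hp ends x (isUpperSet_setOf_mem b)
  have hg0 : ∀ W, 0 ≤ delClusterProb p ends x {W | b ∈ W} W :=
    delClusterProb_nonneg p hp ends x _
  have hg1 : ∀ W, delClusterProb p ends x {W | b ∈ W} W ≤ 1 :=
    delClusterProb_le_one p hp ends x _
  have hI0 : ∀ W, 0 ≤ ({W | x ∉ W} : Set (Set V)).indicator (1 : Set V → R) W :=
    fun _ => Set.indicator_apply_nonneg fun _ => zero_le_one
  have hI1 : ∀ W, ({W | x ∉ W} : Set (Set V)).indicator (1 : Set V → R) W ≤ 1 :=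
    fun _ => Set.indicator_apply_le' (fun _ => le_rfl) (fun _ => zero_le_one)
  have hℓ_anti : Antitone (fun W => delClusterProb p ends x {W | b ∈ W} W *
      ({W | x ∉ W} : Set (Set V)).indicator (1 : Set V → R) W) := fun W W' h =>
    mul_le_mul (hg_anti h) (antitone_indicator_notMem x h) (hI0 _) (hg0 _)
  have hℓ1 : ∀ W, delClusterProb p ends x {W | b ∈ W} W *
      ({W | x ∉ W} : Set (Set V)).indicator (1 : Set V → R) W ≤ 1 := fun W =>
    mul_le_one₀ (hg1 W) (hI0 W) (hI1 W)
  have hF₂ : Monotone (fun W => ({W | b ∈ W} : Set (Set V)).indicator (1 : Set V → R) W +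
      (1 - delClusterProb p ends x {W | b ∈ W} W *
        ({W | x ∉ W} : Set (Set V)).indicator (1 : Set V → R) W)) := fun W W' h =>
    add_le_add (hFb h) (sub_le_sub_left (hℓ_anti h) 1)
  have hF₁0 : ∀ W, 0 ≤ ({W | o ∈ W} : Set (Set V)).indicator (1 : Set V → R) W :=
    fun _ => Set.indicator_apply_nonneg fun _ => zero_le_one
  have hF₂0 : ∀ W, 0 ≤ ({W | b ∈ W} : Set (Set V)).indicator (1 : Set V → R) W +
      (1 - delClusterProb p ends x {W | b ∈ W} W *
        ({W | x ∉ W} : Set (Set V)).indicator (1 : Set V → R) W) := fun W =>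
    add_nonneg (Set.indicator_apply_nonneg fun _ => zero_le_one) (sub_nonneg.2 (hℓ1 W))
  -- the functional BHK inequality with `X = Y = {x}`
  have key := bhk_induced p hp ends a₂ hFo hF₂ hF₁0 hF₂0 Finset.univ {x} {x}
    (Finset.subset_univ _) (Finset.subset_univ _)
  simp only [Finset.inter_self, Finset.union_self, REvent_univ] at key
  have e : ∀ F : Set V → R, clusterObs ends Finset.univ a₂ F * (avoidAll ends a₂ {x}).indicator 1 =
      fun ω => F (cluster ends ω a₂) * (avoidAll ends a₂ {x}).indicator 1 ω := by
    intro F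
    funext ω
    simp only [Pi.mul_apply, clusterObs_apply, clusterIn_univ]
  rw [e, e, e] at key
  simp only [Pi.mul_apply] at key
  -- the two expectations of the shifted functional, in the atoms
  have pR := indicator_notMem_cluster_eq (ends := ends) (R := R) a₂ x
  have pI := indicator_one_mul_self (R := R) (avoidAll ends a₂ {x})
  have e1 : expect p (fun ω => (({W | b ∈ W} : Set (Set V)).indicator 1 (cluster ends ω a₂) +
      (1 - delClusterProb p ends x {W | b ∈ W} (cluster ends ω a₂) *
        ({W | x ∉ W} : Set (Set V)).indicator 1 (cluster ends ω a₂))) *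
      (avoidAll ends a₂ {x}).indicator 1 ω) =
      expect p (fun ω => ({W | b ∈ W} : Set (Set V)).indicator 1 (cluster ends ω a₂) *
          (avoidAll ends a₂ {x}).indicator 1 ω) +
        prob p (avoidAll ends a₂ {x}) -
        expect p (fun ω => delClusterProb p ends x {W | b ∈ W} (cluster ends ω a₂) *
          (avoidAll ends a₂ {x}).indicator 1 ω) := by
    rw [prob_eq_expect_indicator, ← expect_add, ← expect_sub]
    congr 1
    funext ω
    simp only [Pi.add_apply, Pi.sub_apply, pR ω]
    linear_combination (-(delClusterProb p ends x {W | b ∈ W} (cluster ends ω a₂))) * pI ω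
  have e2 : expect p (fun ω => ({W | o ∈ W} : Set (Set V)).indicator 1 (cluster ends ω a₂) *
      (({W | b ∈ W} : Set (Set V)).indicator 1 (cluster ends ω a₂) +
      (1 - delClusterProb p ends x {W | b ∈ W} (cluster ends ω a₂) *
        ({W | x ∉ W} : Set (Set V)).indicator 1 (cluster ends ω a₂))) *
      (avoidAll ends a₂ {x}).indicator 1 ω) =
      expect p (fun ω => ({W | b ∈ W} : Set (Set V)).indicator 1 (cluster ends ω a₂) *
          ({W | o ∈ W} : Set (Set V)).indicator 1 (cluster ends ω a₂) *
          (avoidAll ends a₂ {x}).indicator 1 ω) +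
        expect p (fun ω => ({W | o ∈ W} : Set (Set V)).indicator 1 (cluster ends ω a₂) *
          (avoidAll ends a₂ {x}).indicator 1 ω) -
        expect p (fun ω => ({W | o ∈ W} : Set (Set V)).indicator 1 (cluster ends ω a₂) *
          delClusterProb p ends x {W | b ∈ W} (cluster ends ω a₂) *
          (avoidAll ends a₂ {x}).indicator 1 ω) := by
    rw [← expect_add, ← expect_sub]
    congr 1
    funext ω
    simp only [Pi.add_apply, Pi.sub_apply, pR ω]
    linear_combination (-(({W | o ∈ W} : Set (Set V)).indicator 1 (cluster ends ω a₂) *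
      delClusterProb p ends x {W | b ∈ W} (cluster ends ω a₂))) * pI ω
  rw [← e1, ← e2]
  exact key

omit [Fintype V] [DecidableEq V] in
/-- **Harris for `1_o`**: `poH ≤ a · r`. -/
theorem harris_o (p : E → R) (hp : IsProbVec p) (ends : E → Sym2 V) (x a₂ o : V) :
    expect p (fun ω => ({W | o ∈ W} : Set (Set V)).indicator 1 (cluster ends ω a₂) *
        (avoidAll ends a₂ {x}).indicator 1 ω) ≤
      expect p (fun ω => ({W | o ∈ W} : Set (Set V)).indicator 1 (cluster ends ω a₂)) *
        prob p (avoidAll ends a₂ {x}) := by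
  have hmono : Monotone (fun ω : Config E =>
      ({W | o ∈ W} : Set (Set V)).indicator (1 : Set V → R) (cluster ends ω a₂)) :=
    fun ω ω' h => monotone_indicator_one_of_isUpperSet (isUpperSet_setOf_mem o) (cluster_mono h a₂)
  exact expect_mul_indicator_le_of_isLowerSet hp hmono (isLowerSet_avoidAll_singleton ends a₂ x)

omit [Fintype V] [DecidableEq V] in
/-- **Harris for `ψ = 1_b − ℓ`**: `pbH − pbL ≤ (c − pbL) · r`. -/
theorem harris_psi (p : E → R) (hp : IsProbVec p) (ends : E → Sym2 V) (x a₂ b : V) :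
    expect p (fun ω => ({W | b ∈ W} : Set (Set V)).indicator 1 (cluster ends ω a₂) *
          (avoidAll ends a₂ {x}).indicator 1 ω) -
        expect p (fun ω => delClusterProb p ends x {W | b ∈ W} (cluster ends ω a₂) *
          (avoidAll ends a₂ {x}).indicator 1 ω) ≤
      (expect p (fun ω => ({W | b ∈ W} : Set (Set V)).indicator 1 (cluster ends ω a₂)) -
        expect p (fun ω => delClusterProb p ends x {W | b ∈ W} (cluster ends ω a₂) *
          (avoidAll ends a₂ {x}).indicator 1 ω)) *
        prob p (avoidAll ends a₂ {x}) := by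
  classical
  have hg_anti : Antitone (delClusterProb p ends x {W | b ∈ W}) :=
    delClusterProb_anti p hp ends x (isUpperSet_setOf_mem b)
  have hg0 : ∀ W, 0 ≤ delClusterProb p ends x {W | b ∈ W} W :=
    delClusterProb_nonneg p hp ends x _
  have hI0 : ∀ W, 0 ≤ ({W | x ∉ W} : Set (Set V)).indicator (1 : Set V → R) W :=
    fun _ => Set.indicator_apply_nonneg fun _ => zero_le_one
  have hℓ_anti : Antitone (fun W => delClusterProb p ends x {W | b ∈ W} W *
      ({W | x ∉ W} : Set (Set V)).indicator (1 : Set V → R) W) := fun W W' h =>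
    mul_le_mul (hg_anti h) (antitone_indicator_notMem x h) (hI0 _) (hg0 _)
  have hmono : Monotone (fun ω : Config E =>
      ({W | b ∈ W} : Set (Set V)).indicator (1 : Set V → R) (cluster ends ω a₂) -
        delClusterProb p ends x {W | b ∈ W} (cluster ends ω a₂) *
          ({W | x ∉ W} : Set (Set V)).indicator (1 : Set V → R) (cluster ends ω a₂)) :=
    fun ω ω' h => sub_le_sub
      (monotone_indicator_one_of_isUpperSet (isUpperSet_setOf_mem b) (cluster_mono h a₂))
      (hℓ_anti (cluster_mono h a₂))
  have key := expect_mul_indicator_le_of_isLowerSet hp hmono (isLowerSet_avoidAll_singleton ends a₂ x)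
  have pR := indicator_notMem_cluster_eq (ends := ends) (R := R) a₂ x
  have pI := indicator_one_mul_self (R := R) (avoidAll ends a₂ {x})
  have e1 : expect p ((fun ω : Config E =>
      ({W | b ∈ W} : Set (Set V)).indicator (1 : Set V → R) (cluster ends ω a₂) -
        delClusterProb p ends x {W | b ∈ W} (cluster ends ω a₂) *
          ({W | x ∉ W} : Set (Set V)).indicator (1 : Set V → R) (cluster ends ω a₂)) *
      (avoidAll ends a₂ {x}).indicator 1) =
      expect p (fun ω => ({W | b ∈ W} : Set (Set V)).indicator 1 (cluster ends ω a₂) *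
          (avoidAll ends a₂ {x}).indicator 1 ω) -
        expect p (fun ω => delClusterProb p ends x {W | b ∈ W} (cluster ends ω a₂) *
          (avoidAll ends a₂ {x}).indicator 1 ω) := by
    rw [← expect_sub]
    congr 1
    funext ω
    simp only [Pi.mul_apply, Pi.sub_apply, pR ω]
    linear_combination (-(delClusterProb p ends x {W | b ∈ W} (cluster ends ω a₂))) * pI ω
  have e2 : expect p (fun ω : Config E =>
      ({W | b ∈ W} : Set (Set V)).indicator (1 : Set V → R) (cluster ends ω a₂) -
        delClusterProb p ends x {W | b ∈ W} (cluster ends ω a₂) *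
          ({W | x ∉ W} : Set (Set V)).indicator (1 : Set V → R) (cluster ends ω a₂)) =
      expect p (fun ω => ({W | b ∈ W} : Set (Set V)).indicator 1 (cluster ends ω a₂)) -
        expect p (fun ω => delClusterProb p ends x {W | b ∈ W} (cluster ends ω a₂) *
          (avoidAll ends a₂ {x}).indicator 1 ω) := by
    rw [← expect_sub]
    congr 1
    funext ω
    simp only [Pi.sub_apply, pR ω]
  rw [e1, e2] at key
  exact key

/-- **The (K) inequality** (MINE2-CUTVERTEX §13.9′/§13.12): for a source `a₂`, an avoided vertex
`x` and marks `o`, `b` of a finite graph with any edge weights,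
`[P(a₂↔o)·P(x↔b, a₂↮x) − P(a₂↔o, x↔b, a₂↮x)] + [P(a₂↔b, a₂↔o, a₂↮x) − P(a₂↔o)·P(a₂↔b, a₂↮x)]
  + P(a₂↔b)·[P(a₂↮x)·P(a₂↔o) − P(a₂↔o, a₂↮x)] ≥ 0`. -/
theorem K_nonneg (p : E → R) (hp : IsProbVec p) (ends : E → Sym2 V) (x a₂ o b : V) :
    0 ≤ prob p (connEvent ends a₂ o) * prob p (connEvent ends x b ∩ avoidAll ends a₂ {x})
        - prob p (connEvent ends a₂ o ∩ connEvent ends x b ∩ avoidAll ends a₂ {x})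
        + prob p (connEvent ends a₂ b ∩ connEvent ends a₂ o ∩ avoidAll ends a₂ {x})
        - prob p (connEvent ends a₂ o) * prob p (connEvent ends a₂ b ∩ avoidAll ends a₂ {x})
        + prob p (connEvent ends a₂ b) *
          (prob p (avoidAll ends a₂ {x}) * prob p (connEvent ends a₂ o)
            - prob p (connEvent ends a₂ o ∩ avoidAll ends a₂ {x})) := by
  classical
  have hr0 : 0 ≤ prob p (avoidAll ends a₂ {x}) := prob_nonneg hp _
  rcases eq_or_lt_of_le hr0 with hr | hr
  · -- `r = 0`: every `R`-atom vanishes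
    have hz : ∀ A : Set (Config E), prob p (A ∩ avoidAll ends a₂ {x}) = 0 := fun A =>
      le_antisymm ((prob_mono hp Set.inter_subset_right).trans hr.symm.le) (prob_nonneg hp _)
    rw [hz, hz, hz, hz, hz, ← hr]
    simp
  -- `r > 0`: the atoms as expectations
  have hJHH : prob p (connEvent ends a₂ b ∩ connEvent ends a₂ o ∩ avoidAll ends a₂ {x}) =
      expect p (fun ω => ({W | b ∈ W} : Set (Set V)).indicator 1 (cluster ends ω a₂) *
        ({W | o ∈ W} : Set (Set V)).indicator 1 (cluster ends ω a₂) *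
        (avoidAll ends a₂ {x}).indicator 1 ω) := by
    have h := prob_clusterInEvent_inter_eq_expect p ends a₂ ({W | b ∈ W} ∩ {W | o ∈ W})
      (avoidAll ends a₂ {x})
    rw [clusterInEvent_inter, clusterInEvent_setOf_mem, clusterInEvent_setOf_mem,
      Set.inter_indicator_one] at h
    simp only [Pi.mul_apply] at h
    exact h
  have hpbL : prob p (connEvent ends x b ∩ avoidAll ends a₂ {x}) =
      expect p (fun ω => delClusterProb p ends x {W | b ∈ W} (cluster ends ω a₂) *
        (avoidAll ends a₂ {x}).indicator 1 ω) := by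
    have h := prob_connEvent_x_inter_avoid_eq_expect p ends a₂ x b Set.univ
    simp only [clusterInEvent_univ, Set.univ_inter, Set.indicator_univ, Pi.one_apply,
      one_mul] at h
    exact h
  have hJLH : prob p (connEvent ends a₂ o ∩ connEvent ends x b ∩ avoidAll ends a₂ {x}) =
      expect p (fun ω => ({W | o ∈ W} : Set (Set V)).indicator 1 (cluster ends ω a₂) *
        delClusterProb p ends x {W | b ∈ W} (cluster ends ω a₂) *
        (avoidAll ends a₂ {x}).indicator 1 ω) := by
    have h := prob_connEvent_x_inter_avoid_eq_expect p ends a₂ x b {W | o ∈ W}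
    rw [clusterInEvent_setOf_mem] at h
    exact h
  have hpbL0 : 0 ≤ prob p (connEvent ends x b ∩ avoidAll ends a₂ {x}) := prob_nonneg hp _
  have key := bhk_K p hp ends x a₂ o b
  have h1 := harris_o p hp ends x a₂ o
  have h2 := harris_psi p hp ends x a₂ b
  rw [← prob_connEvent_inter_avoid_eq_expect, ← prob_connEvent_inter_avoid_eq_expect, ← hpbL,
    ← hJHH, ← hJLH] at key
  rw [← prob_connEvent_inter_avoid_eq_expect, ← prob_connEvent_eq_expect] at h1
  rw [← prob_connEvent_inter_avoid_eq_expect, ← hpbL, ← prob_connEvent_eq_expect] at h2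
  exact nonneg_of_mul_nonneg_right (K_algebra hr0 hpbL0 key h1 h2) hr

end Main

end Summit.Ventures.PercRepro2.CutVK
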